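import Mathlib
import Summits.ValiantsHypothesis.ValiantsHypothesis.Theses.CirculantFourier
import Summits.ValiantsHypothesis.ValiantsHypothesis.Theorems.CirculantFourierRealFormsRealify
import Literature.Computability.AlgebraicComplexity.ArithCircuitProofs
import Literature.Computability.AlgebraicComplexity.IMMInVPProofs
import Literature.Computability.AlgebraicComplexity.PermanentCompleteness

/-!
# Route `CirculantFourier`, support item `RealForms` (stmt-ValiantsHypothesis-6310)

`realForms_proof : RealForms` — uniformly in `n ≥ 1`, the Fourier form
`QF_n(μ) = q_n(x(μ))`, `x_d = Σ_m e^{2πi dm/n} μ_m`, of the circulant permanent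
`q_n = per(circulant(x_0, …, x_{n-1}))` is the image of a REAL polynomial `r_n` with
`deg r_n ≤ n` and `L_ℝ(r_n) ≤ 12 · (L_ℂ(q_n) + n² + 1)`.

* REALITY of the coefficients of `QF_n`: coefficientwise complex conjugation maps the Fourier
  substitution `x_d` to `x_{-d}`, i.e. renames the variables of `q_n` along `i ↦ -i`, which
  replaces the circulant matrix by its transpose (`Matrix.Fin.transpose_circulant`); the permanent
  is transpose-invariant (`Matrix.permanent_transpose`) and `q_n` has rational coefficients, so
  `conj QF_n = QF_n` (`MvPolynomial.map_bind₁`, `MvPolynomial.bind₁_rename`).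
* DEGREE: `q_n` is a sum of products of `n` entries and the substituted forms are linear.
* COMPLEXITY: `L_ℂ(QF_n) ≤ L_ℂ(q_n) + 2n²` by the substitution bound `complexity_aeval_le`
  (Bürgisser 2000, Rem. 2.7; each linear form costs `≤ 2n` gates), and the coefficientwise real
  part of a complex polynomial costs a factor `≤ 6` over `ℝ`
  (`RealForms.exists_realPart_complexity_le`, sibling file `CirculantFourierRealFormsRealify`).
-/

namespace Summit.ValiantsHypothesis.ValiantsHypothesis.Theorems

-- `Summit.ValiantsHypothesis.ValiantsHypothesis.…` is the tree's mandated single-conjunct layout (Sub = Summit).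
set_option linter.dupNamespace false

open MvPolynomial Literature.Computability.AlgebraicComplexity

noncomputable section

namespace RealForms

/-- ROOTS OF UNITY. Complex conjugation sends the Fourier coefficient `exp(2πi·d·m/n)` to the
coefficient with `d` replaced by `-d (mod n)`. -/
theorem conj_exp_root (n : ℕ) (d m : Fin n) :
    (starRingEnd ℂ) (Complex.exp (2 * Real.pi * Complex.I * ((d : ℕ) : ℂ) * ((m : ℕ) : ℂ) / (n : ℂ))) =
      Complex.exp (2 * Real.pi * Complex.I * (((-d : Fin n) : ℕ) : ℂ) * ((m : ℕ) : ℂ) / (n : ℂ)) := by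
  have hn : 0 < n := d.pos
  haveI : NeZero n := ⟨hn.ne'⟩
  have hdvd : n ∣ ((-d : Fin n) : ℕ) + (d : ℕ) := by
    apply Nat.dvd_of_mod_eq_zero
    have h := Fin.val_add (-d) d
    rw [neg_add_cancel, Fin.val_zero] at h
    exact h.symm
  obtain ⟨k, hk⟩ := hdvd
  have hcast : (((-d : Fin n) : ℕ) : ℂ) = (n : ℂ) * (k : ℂ) - ((d : ℕ) : ℂ) := by
    rw [eq_sub_iff_add_eq]; exact_mod_cast hk
  have hn' : (n : ℂ) ≠ 0 := Nat.cast_ne_zero.mpr hn.ne'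
  rw [← Complex.exp_conj]
  have h1 : (starRingEnd ℂ) (2 * Real.pi * Complex.I * ((d : ℕ) : ℂ) * ((m : ℕ) : ℂ) / (n : ℂ)) =
      -(2 * Real.pi * Complex.I * ((d : ℕ) : ℂ) * ((m : ℕ) : ℂ) / (n : ℂ)) := by
    simp only [map_div₀, map_mul, map_natCast, map_ofNat, Complex.conj_ofReal, Complex.conj_I]
    ring
  have h2 : 2 * Real.pi * Complex.I * (((-d : Fin n) : ℕ) : ℂ) * ((m : ℕ) : ℂ) / (n : ℂ) =
      ((k * (m : ℕ) : ℕ) : ℂ) * (2 * Real.pi * Complex.I) -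
        2 * Real.pi * Complex.I * ((d : ℕ) : ℂ) * ((m : ℕ) : ℂ) / (n : ℂ) := by
    rw [hcast]; push_cast; field_simp
  rw [h1, h2, Complex.exp_sub, Complex.exp_nat_mul_two_pi_mul_I, Complex.exp_neg, one_div]

/-- LINEAR FORMS have total degree `≤ 1`. -/
theorem totalDegree_linform_le {n : ℕ} (c : Fin n → ℂ) :
    (∑ m : Fin n, C (c m) * (X m : MvPolynomial (Fin n) ℂ)).totalDegree ≤ 1 := by
  refine totalDegree_finsetSum_le fun m _ => ?_
  calc (C (c m) * (X m : MvPolynomial (Fin n) ℂ)).totalDegree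
      ≤ (C (c m) : MvPolynomial (Fin n) ℂ).totalDegree + (X m : MvPolynomial (Fin n) ℂ).totalDegree :=
        totalDegree_mul _ _
    _ ≤ 1 := by rw [totalDegree_C, totalDegree_X]

/-- LINEAR FORMS in `n` variables cost at most `2n` gates. -/
theorem complexity_linform_le {n : ℕ} (c : Fin n → ℂ) :
    complexity (∑ m : Fin n, C (c m) * (X m : MvPolynomial (Fin n) ℂ)) ≤ 2 * n := by
  calc complexity (∑ m : Fin n, C (c m) * (X m : MvPolynomial (Fin n) ℂ))
      ≤ ∑ m : Fin n, complexity (C (c m) * (X m : MvPolynomial (Fin n) ℂ)) + (Finset.univ : Finset (Fin n)).card :=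
        complexity_finset_sum_le _ _
    _ ≤ ∑ _m : Fin n, 1 + (Finset.univ : Finset (Fin n)).card := by
        gcongr with m _
        calc complexity (C (c m) * (X m : MvPolynomial (Fin n) ℂ))
            ≤ complexity (C (c m) : MvPolynomial (Fin n) ℂ) + complexity (X m : MvPolynomial (Fin n) ℂ) + 1 :=
              complexity_mul_le_holds _ _
          _ = 1 := by rw [complexity_C_holds, complexity_X_holds]
    _ = 2 * n := by simp; ring

/-- THE CIRCULANT PERMANENT is fixed by every change of coefficients (its coefficients are `0/1`). -/
theorem map_circPerm (n : ℕ) (f : ℂ →+* ℂ) :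
    map f (Matrix.circulant fun i : Fin n => (X i : MvPolynomial (Fin n) ℂ)).permanent =
      (Matrix.circulant fun i : Fin n => (X i : MvPolynomial (Fin n) ℂ)).permanent := by
  rw [← Matrix.permanent_map_ringHom, Matrix.map_circulant]
  simp only [map_X]

/-- THE CIRCULANT PERMANENT is invariant under negating the variable indices
(`per(Cᵀ) = per(C)` and `circulant(v)ᵀ = circulant(v ∘ neg)`). -/
theorem rename_neg_circPerm (n : ℕ) :
    rename (fun i : Fin n => -i) (Matrix.circulant fun i : Fin n => (X i : MvPolynomial (Fin n) ℂ)).permanent =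
      (Matrix.circulant fun i : Fin n => (X i : MvPolynomial (Fin n) ℂ)).permanent := by
  have h := Matrix.permanent_map_ringHom (rename fun i : Fin n => -i).toRingHom
    (Matrix.circulant fun i : Fin n => (X i : MvPolynomial (Fin n) ℂ))
  simp only [AlgHom.toRingHom_eq_coe, RingHom.coe_coe, Matrix.map_circulant, rename_X] at h
  rw [← h, ← Matrix.Fin.transpose_circulant, Matrix.permanent_transpose]

/-- DEGREE. Substituting polynomials of degree `≤ 1` into the circulant permanent gives degree `≤ n`. -/
theorem totalDegree_aeval_circPerm_le {n : ℕ} {τ : Type*} (g : Fin n → MvPolynomial τ ℂ)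
    (hg : ∀ d, (g d).totalDegree ≤ 1) :
    (aeval g (Matrix.circulant fun i : Fin n => (X i : MvPolynomial (Fin n) ℂ)).permanent).totalDegree ≤ n := by
  simp only [Matrix.permanent, map_sum, map_prod, Matrix.circulant_apply, aeval_X]
  refine totalDegree_finsetSum_le fun σ _ => ?_
  calc (∏ i : Fin n, g (σ i - i)).totalDegree ≤ ∑ i : Fin n, (g (σ i - i)).totalDegree :=
        totalDegree_finsetProd _ _
    _ ≤ ∑ _i : Fin n, 1 := Finset.sum_le_sum fun i _ => hg _
    _ = n := by simp

end RealForms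

open RealForms in
/-- `RealForms` (stmt-ValiantsHypothesis-6310): uniformly in `n ≥ 1`, the Fourier form `QF_n` of the
circulant permanent is the image of a real polynomial `r_n` of total degree `≤ n` with
`L_ℝ(r_n) ≤ 12 · (L_ℂ(q_n) + n² + 1)`. Proof: `QF_n` is fixed by coefficientwise conjugation
(conjugation negates the row index of the Fourier substitution, which transposes the circulant,
and `per` is transpose-invariant), so its coefficients are real; `L_ℂ(QF_n) ≤ L_ℂ(q_n) + 2n²` by
substituting the `n` linear forms; and the real part of a complex circuit costs a factor `6`
(`RealForms.exists_realPart_complexity_le`). -/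
theorem realForms_proof : Summit.ValiantsHypothesis.ValiantsHypothesis.Theses.CirculantFourier.RealForms := by
  refine ⟨12, fun n hn => ?_⟩
  -- abbreviations
  set L : Fin n → MvPolynomial (Fin n) ℂ := fun d : Fin n => ∑ m : Fin n,
    MvPolynomial.C (Complex.exp (2 * Real.pi * Complex.I * ((d : ℕ) : ℂ) * ((m : ℕ) : ℂ) / (n : ℂ))) *
      MvPolynomial.X m with hL
  set q : MvPolynomial (Fin n) ℂ :=
    (Matrix.circulant fun i : Fin n => (MvPolynomial.X i : MvPolynomial (Fin n) ℂ)).permanent with hq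
  -- (1) reality: `map conj (aeval L q) = aeval L q`
  have hconjL : ∀ d, map (starRingEnd ℂ) (L d) = L (-d) := by
    intro d
    simp only [hL, map_sum, map_mul, map_C, map_X, conj_exp_root]
  have hconj : map (starRingEnd ℂ) (aeval L q) = aeval L q := by
    rw [aeval_eq_bind₁, map_bind₁, map_circPerm]
    rw [show (fun d => map (starRingEnd ℂ) (L d)) = L ∘ (fun i : Fin n => -i) from funext hconjL]
    rw [← bind₁_rename, rename_neg_circPerm]
  have him : ∀ m, (coeff m (aeval L q)).im = 0 := by
    intro m
    rw [← Complex.conj_eq_iff_im, ← coeff_map, hconj]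
  -- (2) real part and its complexity
  obtain ⟨x, y, hxy, hcx⟩ := exists_realPart_complexity_le (aeval L q)
  have hreal : map Complex.ofRealHom x = aeval L q := map_ofRealHom_eq_of_im_eq_zero hxy him
  refine ⟨x, hreal, ?_, ?_⟩
  · -- (3) degree
    have hdeg : (aeval L q).totalDegree ≤ n :=
      totalDegree_aeval_circPerm_le L fun d => totalDegree_linform_le _
    have hsupp : x.totalDegree = (map Complex.ofRealHom x).totalDegree := by
      rw [totalDegree, totalDegree, support_map_of_injective _ Complex.ofRealHom.injective]
    rw [hsupp, hreal]
    exact hdeg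
  · -- (4) complexity
    have hF : complexity (aeval L q) ≤ complexity q + 2 * (n * n) := by
      calc complexity (aeval L q) ≤ complexity q + ∑ d : Fin n, complexity (L d) :=
            complexity_aeval_le q L
        _ ≤ complexity q + ∑ _d : Fin n, 2 * n := by
            gcongr with d _
            exact complexity_linform_le _
        _ = complexity q + 2 * (n * n) := by simp; ring
    calc complexity x ≤ 6 * complexity (aeval L q) := hcx
      _ ≤ 6 * (complexity q + 2 * (n * n)) := by gcongr
      _ ≤ 12 * (complexity q + n * n + 1) := by ring_nf; omega

end

end Summit.ValiantsHypothesis.ValiantsHypothesis.Theorems
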